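import Mathlib
import Summits.NavierStokesRegularity.NavierStokesRegularity.Theses.DulacContraction
import HarnessLib

/-!
# Route DulacContraction — `Assembly` PROVED (stmt-NavierStokesRegularity-8565; pure logic)

`SynchronizationModSimilarity → SynchronizationForcesSelfSimilarity → RDSSLiouvilleInClass →
RecurrentReduction → SmoothRepresentative → TypeIBlowupProfile → NoTypeII → ClayFromNoBlowup →
NavierStokesRegularity` is, by definition, the type of the route's deciding theorem `closes`
(kernel-checked in the route file); the item is closed by that theorem, by name.

HONEST FRAMING: pure logic; every hypothesis remains an OPEN item of the route; nothing here bears on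
the regularity question. Lands `--workitem stmt-NavierStokesRegularity-8565` (typer seat g19 of cell
pub-ns-dss, idle-row item).
-/

namespace Summit.NavierStokesRegularity.NavierStokesRegularity.Theorems

set_option linter.dupNamespace false

/-- **`Assembly` of route DulacContraction (stmt-NavierStokesRegularity-8565)** = the route's deciding
theorem `Theses.DulacContraction.closes`, curried. [this file] -/
theorem dulacContraction_assembly_proof : Theses.DulacContraction.Assembly :=
  fun hK1 hK2 hW hRec hRep hProf hII hClay =>
    Theses.DulacContraction.closes hK1 hK2 hW hRec hRep hProf hII hClay

end Summit.NavierStokesRegularity.NavierStokesRegularity.Theorems
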